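import Literature.MathematicalPhysics.QuantumFieldTheory.Balaban1983to89.B2LargeField

/-!
# `Balaban1983to89.B2Ineq213SmallFactors` — T. Bałaban, *(Higgs)₂,₃ quantum fields in a finite volume. II. An upper bound*, Commun. Math. Phys. **86** (1982) 555–594 [Balaban1982Higgs2]: the SMALL-FACTOR inequality **(2.13)** p. 559 — `χ^c_{R_s} exp[−Σ_{x∈Λ₇ᶜ}(λ(ε)|φ(x)|⁴ + ½δm²ε²|φ(x)|²)] ≤ exp(−½p(ε)⁴|R_s|)exp(O(ε^{κ₀})|Λ₇ᶜ|) ≤ exp(−p(ε)²|R_s|)exp(O(ε^{κ₀})|Λ₇ᶜ|)` — PROVED from (2.11)–(2.12)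

statement-level skeleton of published theorems with citation tags; proofs where landed; nothing here is a claim about the Yang–Mills mass gap

PDF held: `paper:balaban1982-cmp86-higgs23-ii` (doi 10.1007/bf01214890; journal page = PDF page + 554); p. 559 [PDF 5] READ AS
AN IMAGE on the ×2 render `run/shared/lean/pub/pub-balaban/b2b-balaban-ref1/pages/1982-cmp86-higgs23-II/1982-cmp86-higgs23-II-p005-x2.png`
(thresholds (2.2)/(2.5): p. 557, render `…-p003-x2.png`).

CITATION HEADER — WHAT IS REPRODUCED.  SKELETON row **B2.Eq2.13** ((2.11)–(2.14) p. 559) of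
`run/shared/lean/pub/lit-balaban/SKELETON.md`: the kernel of (2.11)–(2.12) is PROVED in unit r14's `B2LargeField`
(`display211`, `quartic_quadratic_half`, thresholds `thrPhi`, `lambdaEps`); its module docstring records *"(2.13)–(2.15):
quoted … not typed"*.  This file types AND proves the member (2.13).  ((2.14), the split of E₁, is B3's — not touched.)
Unit `lit-balaban-p15` (Phase-2 proof seat p15, generation 2; HOME `run/shared/lean/pub/lit-balaban/`); B2 fold owner r02,
second reader r14 (author of `B2LargeField`); referee ref-4.

THE PRINTED TEXT (p. 559, verbatim).  *"δm² = O(ε⁻¹) for d = 3 and δm² = O(1 + log ε⁻¹) for d = 2. Hence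
λ(ε)|φ|⁴ + ½δm²ε²|φ|² ≥ −O(ε^{κ₀}), (2.11)  where κ₀ = 1 for d = 3 and κ₀ = 2 − α with arbitary α > 0 for d = 2, and
λ(ε)|φ|⁴ + ½δm²ε²|φ|² ≥ ½λ(ε)|φ|⁴ for |φ|² ≥ O(1)(1 + log ε⁻¹). (2.12)  From these estimates we get the following one
  χ^c_{R_s} exp[−Σ_{x∈Λ₇ᶜ}(λ(ε)|φ(x)|⁴ + ½δm²ε²|φ(x)|²)] ≤ exp(−½p(ε)⁴|R_s|) exp(O(ε^{κ₀})|Λ₇ᶜ|)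
    ≤ exp(−p(ε)²|R_s|) exp(O(ε^{κ₀})|Λ₇ᶜ|). (2.13)"*
Here (p. 557, (2.2)/(2.5)) `χ^c_{R_s}` is the characteristic function of the event that the scalar field is LARGE at
every point of `R_s`: `|φ(x)| > (1/λ(ε)^{1/4})p(ε)`, `x ∈ R_s` (`B2LargeField.thrPhi`; `λ(ε) = λε^{4−d}` =
`B2LargeField.lambdaEps`), and `R_s ⊂ Λ₀ᶜ ⊂ Λ₇ᶜ` ((2.7)–(2.8)).

DICTIONARY.  Sites: a type `X`; `Λc : Finset X` ↤ Λ₇ᶜ, `R : Finset X` ↤ R_s with `R ⊆ Λc`; `t x` ↤ |φ(x)| (≥ 0);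
`lam'` ↤ λ(ε) (> 0), `m` ↤ ½δm²ε² (any sign), `pε` ↤ p(ε), `C·ε^{κ₀}` ↤ the printed O(ε^{κ₀}) of (2.11); the summand
λ(ε)|φ|⁴ + ½δm²ε²|φ|² = `lam' * (t x ^ 2) ^ 2 + m * t x ^ 2` (the letters of `B2LargeField.display211`).  HYPOTHESES,
exactly the two printed inputs: (2.11) in the form r14 proved it (`m² ≤ 4λ(ε)·Cε^{κ₀}`, the B3-deferred counterterm
bound), and, for (2.12) ON `R_s`, that the large-field threshold `θ = p(ε)/λ(ε)^{1/4}` lies above the (2.12)-threshold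
`−2m/λ(ε) = −δm²ε²/λ(ε)` (= the printed *"O(1)(1 + log ε⁻¹)"*; automatic for ε small since `θ² = p(ε)²λ^{−1/2}ε^{−(4−d)/2}`):
`hθ2 : −2m/λ(ε) ≤ θ²`.  The second inequality of (2.13) needs `p(ε)² ≥ 2` (`½p(ε)⁴ ≥ p(ε)²`), which holds for ε small
(`exists_two_le_pFn_sq`).

WHAT IS KERNEL-CHECKED.  `sum_lower` — `Σ_{x∈Λ₇ᶜ}(…) ≥ ½p(ε)⁴|R_s| − Cε^{κ₀}|Λ₇ᶜ|` on the event (split `Λ₇ᶜ = R_s ⊔ (Λ₇ᶜ∖R_s)`: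
`B2LargeField.quartic_quadratic_half` on `R_s`, `display211` off it); **`ineq213`** (first inequality of (2.13), on the
event), **`ineq213_chi`** (the same with `χ^c_{R_s}` as the `{0,1}`-valued factor `if (∀ x ∈ R_s, θ < |φ(x)|) then 1 else 0`, for ALL fields), **`ineq213_snd`** /
`ineq213_chi_snd` (second inequality, given `p(ε)² ≥ 2`); `thrPhi_pow_four` (`λ(ε)θ⁴ = p(ε)⁴`), **`ineq213_printed`** (the
thresholds instantiated at `B2LargeField.thrPhi`/`lambdaEps`), `exists_two_le_pFn_sq` (`p(ε)² ≥ 2` for ε small, `p > 0`).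
-/

open Finset
open scoped BigOperators

namespace Literature.MathematicalPhysics.QuantumFieldTheory.Balaban1983to89.B2Ineq213SmallFactors

variable {X : Type*}

/-! ## §1 The exponent: lower bound on the event `{|φ| > θ on R_s}` -/

/-- On the event `θ ≤ |φ(x)|, x ∈ R_s`, with (2.11) (as `m² ≤ 4λ(ε)·Cε^{κ₀}`) and the threshold relation `−2m/λ(ε) ≤ θ²`,
`λ(ε)θ⁴ ≥ p(ε)⁴`: `Σ_{x∈Λ₇ᶜ}(λ(ε)|φ(x)|⁴ + ½δm²ε²|φ(x)|²) ≥ ½p(ε)⁴|R_s| − Cε^{κ₀}|Λ₇ᶜ|` — the exponent comparison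
behind the first inequality of (2.13). [cite: Balaban1982Higgs2, (2.13) p.559] -/
theorem sum_lower [DecidableEq X] (Λc R : Finset X) (hRsub : R ⊆ Λc) (t : X → ℝ)
    {lam' m C ε κ₀ pε θ : ℝ} (hl : 0 < lam') (hCε : 0 ≤ C * ε ^ κ₀) (hm : m ^ 2 ≤ 4 * lam' * (C * ε ^ κ₀))
    (hθ : 0 ≤ θ) (hθ4 : pε ^ 4 ≤ lam' * θ ^ 4) (hθ2 : -(2 * m / lam') ≤ θ ^ 2) (hR : ∀ x ∈ R, θ ≤ t x) :
    pε ^ 4 / 2 * R.card - C * ε ^ κ₀ * Λc.card ≤ ∑ x ∈ Λc, (lam' * (t x ^ 2) ^ 2 + m * t x ^ 2) := by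
  -- split Λ₇ᶜ = (Λ₇ᶜ ∖ R_s) ⊔ R_s
  rw [← Finset.sum_sdiff hRsub]
  -- on R_s: each term ≥ ½λθ⁴ ≥ ½p(ε)⁴   ((2.12))
  have hRterm : ∀ x ∈ R, pε ^ 4 / 2 ≤ lam' * (t x ^ 2) ^ 2 + m * t x ^ 2 := by
    intro x hx
    have htx : θ ≤ t x := hR x hx
    have h2 : θ ^ 2 ≤ t x ^ 2 := pow_le_pow_left₀ hθ htx 2
    have h4 : θ ^ 4 ≤ (t x ^ 2) ^ 2 := by
      have := pow_le_pow_left₀ hθ htx 4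
      calc θ ^ 4 ≤ t x ^ 4 := this
        _ = (t x ^ 2) ^ 2 := by ring
    have hhalf := B2LargeField.quartic_quadratic_half hl (sq_nonneg (t x)) (hθ2.trans h2)
    have h5 : pε ^ 4 / 2 ≤ lam' * (t x ^ 2) ^ 2 / 2 := by
      have := mul_le_mul_of_nonneg_left h4 hl.le
      linarith
    exact h5.trans hhalf
  -- off R_s: each term ≥ −Cε^{κ₀}   ((2.11))
  have hCterm : ∀ x ∈ Λc \ R, -(C * ε ^ κ₀) ≤ lam' * (t x ^ 2) ^ 2 + m * t x ^ 2 :=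
    fun x _ => B2LargeField.display211 hl hm (t x)
  have hsumR : (R.card : ℝ) * (pε ^ 4 / 2) ≤ ∑ x ∈ R, (lam' * (t x ^ 2) ^ 2 + m * t x ^ 2) := by
    have h := Finset.card_nsmul_le_sum R (fun x => lam' * (t x ^ 2) ^ 2 + m * t x ^ 2) (pε ^ 4 / 2) hRterm
    simpa [nsmul_eq_mul] using h
  have hsumC : ((Λc \ R).card : ℝ) * (-(C * ε ^ κ₀)) ≤ ∑ x ∈ Λc \ R, (lam' * (t x ^ 2) ^ 2 + m * t x ^ 2) := by
    have h := Finset.card_nsmul_le_sum (Λc \ R) (fun x => lam' * (t x ^ 2) ^ 2 + m * t x ^ 2) (-(C * ε ^ κ₀)) hCterm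
    simpa [nsmul_eq_mul] using h
  have hcard : ((Λc \ R).card : ℝ) ≤ Λc.card := by
    exact_mod_cast Finset.card_le_card Finset.sdiff_subset
  nlinarith [hsumR, hsumC, hcard, hCε]

/-! ## §2 (2.13) -/

/-- **(2.13), first inequality**, on the event `χ^c_{R_s} = 1` (the scalar field exceeds the large-field threshold `θ` at every
point of `R_s`): `exp[−Σ_{x∈Λ₇ᶜ}(λ(ε)|φ(x)|⁴ + ½δm²ε²|φ(x)|²)] ≤ exp(−½p(ε)⁴|R_s|)·exp(Cε^{κ₀}|Λ₇ᶜ|)`.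
[cite: Balaban1982Higgs2, (2.13) p.559] -/
theorem ineq213 [DecidableEq X] (Λc R : Finset X) (hRsub : R ⊆ Λc) (t : X → ℝ)
    {lam' m C ε κ₀ pε θ : ℝ} (hl : 0 < lam') (hCε : 0 ≤ C * ε ^ κ₀) (hm : m ^ 2 ≤ 4 * lam' * (C * ε ^ κ₀))
    (hθ : 0 ≤ θ) (hθ4 : pε ^ 4 ≤ lam' * θ ^ 4) (hθ2 : -(2 * m / lam') ≤ θ ^ 2) (hR : ∀ x ∈ R, θ ≤ t x) :
    Real.exp (-(∑ x ∈ Λc, (lam' * (t x ^ 2) ^ 2 + m * t x ^ 2)))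
      ≤ Real.exp (-(pε ^ 4 / 2 * R.card)) * Real.exp (C * ε ^ κ₀ * Λc.card) := by
  rw [← Real.exp_add, Real.exp_le_exp]
  have h := sum_lower Λc R hRsub t hl hCε hm hθ hθ4 hθ2 hR
  linarith

/-- **(2.13), first inequality, as printed** — with the characteristic function `χ^c_{R_s}` as a factor, for EVERY scalar
field: `χ^c_{R_s}·exp[−Σ_{x∈Λ₇ᶜ}(λ(ε)|φ(x)|⁴ + ½δm²ε²|φ(x)|²)] ≤ exp(−½p(ε)⁴|R_s|)·exp(Cε^{κ₀}|Λ₇ᶜ|)`.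
[cite: Balaban1982Higgs2, (2.13) p.559] -/
theorem ineq213_chi [DecidableEq X] (Λc R : Finset X) (hRsub : R ⊆ Λc) (t : X → ℝ)
    {lam' m C ε κ₀ pε θ : ℝ} (hl : 0 < lam') (hCε : 0 ≤ C * ε ^ κ₀) (hm : m ^ 2 ≤ 4 * lam' * (C * ε ^ κ₀))
    (hθ : 0 ≤ θ) (hθ4 : pε ^ 4 ≤ lam' * θ ^ 4) (hθ2 : -(2 * m / lam') ≤ θ ^ 2) :
    (if ∀ x ∈ R, θ < t x then (1 : ℝ) else 0) * Real.exp (-(∑ x ∈ Λc, (lam' * (t x ^ 2) ^ 2 + m * t x ^ 2)))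
      ≤ Real.exp (-(pε ^ 4 / 2 * R.card)) * Real.exp (C * ε ^ κ₀ * Λc.card) := by
  split_ifs with h
  · rw [one_mul]
    exact ineq213 Λc R hRsub t hl hCε hm hθ hθ4 hθ2 fun x hx => (h x hx).le
  · rw [zero_mul]
    positivity

/-- **(2.13), second inequality**: `exp(−½p(ε)⁴|R_s|) ≤ exp(−p(ε)²|R_s|)` as soon as `p(ε)² ≥ 2` (true for ε small,
`exists_two_le_pFn_sq`). [cite: Balaban1982Higgs2, (2.13) p.559] -/
theorem ineq213_snd (R : Finset X) {pε : ℝ} (hp : 2 ≤ pε ^ 2) (K : ℝ) :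
    Real.exp (-(pε ^ 4 / 2 * R.card)) * Real.exp K ≤ Real.exp (-(pε ^ 2 * R.card)) * Real.exp K := by
  refine mul_le_mul_of_nonneg_right ?_ (Real.exp_pos _).le
  rw [Real.exp_le_exp, neg_le_neg_iff]
  have hR : (0 : ℝ) ≤ R.card := Nat.cast_nonneg _
  have h1 : pε ^ 2 ≤ pε ^ 4 / 2 := by nlinarith [sq_nonneg pε]
  exact mul_le_mul_of_nonneg_right h1 hR

/-- **(2.13), both inequalities, as printed** (`χ^c_{R_s}` a factor, every field): `χ^c_{R_s}·exp[−Σ_{x∈Λ₇ᶜ}(…)] ≤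
exp(−p(ε)²|R_s|)·exp(Cε^{κ₀}|Λ₇ᶜ|)`, under (2.11), the threshold relation for (2.12) on `R_s`, and `p(ε)² ≥ 2`.
[cite: Balaban1982Higgs2, (2.13) p.559] -/
theorem ineq213_chi_snd [DecidableEq X] (Λc R : Finset X) (hRsub : R ⊆ Λc) (t : X → ℝ)
    {lam' m C ε κ₀ pε θ : ℝ} (hl : 0 < lam') (hCε : 0 ≤ C * ε ^ κ₀) (hm : m ^ 2 ≤ 4 * lam' * (C * ε ^ κ₀))
    (hθ : 0 ≤ θ) (hθ4 : pε ^ 4 ≤ lam' * θ ^ 4) (hθ2 : -(2 * m / lam') ≤ θ ^ 2) (hp : 2 ≤ pε ^ 2) :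
    (if ∀ x ∈ R, θ < t x then (1 : ℝ) else 0) * Real.exp (-(∑ x ∈ Λc, (lam' * (t x ^ 2) ^ 2 + m * t x ^ 2)))
      ≤ Real.exp (-(pε ^ 2 * R.card)) * Real.exp (C * ε ^ κ₀ * Λc.card) :=
  (ineq213_chi Λc R hRsub t hl hCε hm hθ hθ4 hθ2).trans (ineq213_snd R hp _)

/-! ## §3 The printed thresholds: `θ = p(ε)/λ(ε)^{1/4}` (`B2LargeField.thrPhi`), `λ(ε) = λε^{4−d}` (`lambdaEps`) -/

/-- `λ(ε)·θ⁴ = p(ε)⁴` for the printed threshold `θ = p(ε)/λ(ε)^{1/4}` ((2.2)/(2.5) p. 557). [cite: Balaban1982Higgs2, (2.5) p.557] -/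
theorem thrPhi_pow_four {lam ε : ℝ} (hl : 0 < lam) (hε : 0 < ε) (d : ℕ) (pε : ℝ) :
    B2LargeField.lambdaEps lam ε d * B2LargeField.thrPhi lam ε d pε ^ 4 = pε ^ 4 := by
  have hL := B2LargeField.lambdaEps_pos hl hε d
  rw [B2LargeField.thrPhi, div_pow]
  have h4 : (B2LargeField.lambdaEps lam ε d ^ (1 / 4 : ℝ)) ^ 4 = B2LargeField.lambdaEps lam ε d := by
    rw [← Real.rpow_natCast, ← Real.rpow_mul hL.le]
    norm_num
  rw [h4]
  field_simp

/-- The printed threshold is non-negative for `p(ε) ≥ 0`. [cite: Balaban1982Higgs2, (2.5) p.557] -/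
theorem thrPhi_nonneg {lam ε : ℝ} (hl : 0 < lam) (hε : 0 < ε) (d : ℕ) {pε : ℝ} (hp : 0 ≤ pε) :
    0 ≤ B2LargeField.thrPhi lam ε d pε :=
  div_nonneg hp (Real.rpow_nonneg (B2LargeField.lambdaEps_pos hl hε d).le _)

/-- **(2.13) at the printed thresholds**: with `λ(ε) = λε^{4−d}` and `χ^c_{R_s}` the characteristic function of
`{|φ(x)| > p(ε)/λ(ε)^{1/4}, x ∈ R_s}`, for every scalar field, `χ^c_{R_s} exp[−Σ_{x∈Λ₇ᶜ}(λ(ε)|φ(x)|⁴ + ½δm²ε²|φ(x)|²)] ≤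
exp(−½p(ε)⁴|R_s|)exp(Cε^{κ₀}|Λ₇ᶜ|) ≤ exp(−p(ε)²|R_s|)exp(Cε^{κ₀}|Λ₇ᶜ|)` — hypotheses: `R_s ⊆ Λ₇ᶜ`; (2.11) as
`(½δm²ε²)² ≤ 4λ(ε)Cε^{κ₀}`; the (2.12)-threshold below the large-field one, `−δm²ε²/λ(ε) ≤ (p(ε)/λ(ε)^{1/4})²`; `p(ε)² ≥ 2`.
[cite: Balaban1982Higgs2, (2.13) p.559] -/
theorem ineq213_printed [DecidableEq X] (Λc R : Finset X) (hRsub : R ⊆ Λc) (absPhi : X → ℝ) {lam ε : ℝ} (hl : 0 < lam) (hε : 0 < ε) (d : ℕ) {m C κ₀ pε : ℝ} (hp0 : 0 ≤ pε)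
    (hCε : 0 ≤ C * ε ^ κ₀) (hm : m ^ 2 ≤ 4 * B2LargeField.lambdaEps lam ε d * (C * ε ^ κ₀))
    (hthr : -(2 * m / B2LargeField.lambdaEps lam ε d) ≤ B2LargeField.thrPhi lam ε d pε ^ 2) (hp : 2 ≤ pε ^ 2) :
    (if ∀ x ∈ R, B2LargeField.thrPhi lam ε d pε < absPhi x then (1 : ℝ) else 0)
        * Real.exp (-(∑ x ∈ Λc, (B2LargeField.lambdaEps lam ε d * (absPhi x ^ 2) ^ 2 + m * absPhi x ^ 2)))
      ≤ Real.exp (-(pε ^ 4 / 2 * R.card)) * Real.exp (C * ε ^ κ₀ * Λc.card) ∧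
    (if ∀ x ∈ R, B2LargeField.thrPhi lam ε d pε < absPhi x then (1 : ℝ) else 0)
        * Real.exp (-(∑ x ∈ Λc, (B2LargeField.lambdaEps lam ε d * (absPhi x ^ 2) ^ 2 + m * absPhi x ^ 2)))
      ≤ Real.exp (-(pε ^ 2 * R.card)) * Real.exp (C * ε ^ κ₀ * Λc.card) := by
  have hL := B2LargeField.lambdaEps_pos hl hε d
  have hθ := thrPhi_nonneg hl hε d hp0
  have hθ4 : pε ^ 4 ≤ B2LargeField.lambdaEps lam ε d * B2LargeField.thrPhi lam ε d pε ^ 4 :=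
    (thrPhi_pow_four hl hε d pε).symm.le
  exact ⟨ineq213_chi Λc R hRsub absPhi hL hCε hm hθ hθ4 hthr,
    ineq213_chi_snd Λc R hRsub absPhi hL hCε hm hθ hθ4 hthr hp⟩

/-! ## §4 `p(ε)² ≥ 2` for ε small -/

/-- For `b₀ > 0`, `p > 0` the function `p(ε) = b₀(1 + log ε⁻¹)^p` of p. 557 satisfies `p(ε)² ≥ 2` for all sufficiently
small ε > 0 (so the second inequality of (2.13) holds there). [cite: Balaban1982Higgs2, (2.13) p.559] -/
theorem exists_two_le_pFn_sq {b₀ p : ℝ} (hb : 0 < b₀) (hp : 0 < p) :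
    ∃ ε₁ : ℝ, 0 < ε₁ ∧ ∀ ε : ℝ, 0 < ε → ε ≤ ε₁ → 2 ≤ B2.pFn b₀ p ε ^ 2 := by
  -- choose T with b₀ T^p ≥ √2, i.e. T = (√2/b₀)^{1/p}, and ε₁ = e^{−T}
  set T : ℝ := (Real.sqrt 2 / b₀) ^ (1 / p) with hT
  have hT0 : 0 ≤ T := Real.rpow_nonneg (div_nonneg (Real.sqrt_nonneg _) hb.le) _
  refine ⟨Real.exp (-T), Real.exp_pos _, fun ε hε hεle => ?_⟩
  have hlog : T ≤ Real.log ε⁻¹ := by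
    rw [Real.log_inv]
    have h := Real.log_le_log hε hεle
    rw [Real.log_exp] at h
    linarith
  have hbase : T ≤ 1 + Real.log ε⁻¹ := by linarith
  have hTp : T ^ p = Real.sqrt 2 / b₀ := by
    rw [hT, ← Real.rpow_mul (div_nonneg (Real.sqrt_nonneg _) hb.le)]
    rw [one_div_mul_cancel hp.ne', Real.rpow_one]
  have hpow : Real.sqrt 2 / b₀ ≤ (1 + Real.log ε⁻¹) ^ p := by
    rw [← hTp]
    exact Real.rpow_le_rpow hT0 hbase hp.le
  have hpF : Real.sqrt 2 ≤ B2.pFn b₀ p ε := by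
    rw [B2.pFn]
    have := mul_le_mul_of_nonneg_left hpow hb.le
    rwa [mul_div_cancel₀ _ hb.ne'] at this
  have hs : (0 : ℝ) ≤ Real.sqrt 2 := Real.sqrt_nonneg _
  calc (2 : ℝ) = Real.sqrt 2 ^ 2 := by rw [Real.sq_sqrt (by norm_num)]
    _ ≤ B2.pFn b₀ p ε ^ 2 := pow_le_pow_left₀ hs hpF 2

end Literature.MathematicalPhysics.QuantumFieldTheory.Balaban1983to89.B2Ineq213SmallFactors
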